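import Mathlib
import Summits.NavierStokesRegularity.NavierStokesRegularity.Theorems.TaoLadderRungTwoFlatNearBehindAprioriSharp
import Summits.NavierStokesRegularity.NavierStokesRegularity.Theorems.TaoLadderRungTwoFlatGradedDeviation
import Summits.NavierStokesRegularity.NavierStokesRegularity.Theorems.TaoLadderRungTwoFlatGradedGauge
import Summits.NavierStokesRegularity.NavierStokesRegularity.Theorems.TaoLadderRungTwoFlatGappedFrontRobustStepTransferOn
import HarnessLib

/-!
# The THREE-ZONE in-hop a-priori loop for GRADED flows: core gauge deviation ⇄ near deviation energy ⇄ behind block energies,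
  closed by one continuous induction — no cross-zone hypothesis on the flows during the hop remains (helper for the K_A♭ parent
  item stmt-NavierStokesRegularity-22987 `FlatGapCertificatesV2`, child 2A `GradedAdiabaticWakeA` of route TaoLadderRungTwoFlat;
  cell harvest/h2-tao-ladder, p1 g23; LADDER §49–§58)

Two exact graded certificate flows on `[0, τ]`: the hop flow `S` and the reference `W`, deviation `u = S − W`.
* CORE: the renormalised-frame gauge Grönwall `MirrorPulse.gauge_deviation_of_gradedFlows` bounds `ω|u(s)| ≤ B·e^{2‖α̃‖₁ M̃ Λ s}` over
  ALL shells from the initial gauge distance `B` and a CLOCK-WEIGHTED sup `M̃` of both flows over all shells;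
* NEAR/BEHIND: `R54.near_behind_apriori_of_pseudoFlows_sharp` bounds the behind clock-weighted amplitudes by `A_eff` and the near
  deviation, given the CORE inputs at the window bottom `1 − K`.
Each needs the other: `M̃` behind the window is the behind loop's `A_eff` (the gauge bound is useless deep behind, `clockW/ω → ∞`);
the behind loop's core inputs are the gauge deviation at `1 − K`. This module runs ONE continuous induction (`Bootstrap.Icc_induction₂`)
on two finite sups over the core shells `k ∈ [1−K, k₀]` — the clock-weighted amplitude of `S` and the gauge deviation — calling the
near/behind loop and the gauge Grönwall on every initial segment `[0, t]` (`GappedFrontRobustOn.pseudoFlowOnShift_mono`); the shells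
beyond `k₀` are controlled by the format clause (4.5) (`apriori_S`: `clockW·|S| → 0` ahead), the shells behind by `A_eff`.

* `clockW_eq_clock` — the two clock normalisations of the tree agree;
* `clockW_abs_eventually_le` — (4.5): `clockW_k|S_{ik}(s)| ≤ M_c` for all `k > k₀(flow, M_c)`, `s ∈ [0, τ]`;
* `hop_apriori_graded` — **the three-zone loop**. Inputs: gauge data (`ω/clockW` window-regular, `clockW ≤ C_ω·ω` on `k ≥ 1−K`,
  `ω_K ≤ ω_i(1−K)`), the reference flow's clock-weighted sup `M̃_W` and template bounds `M`, `M₁`, the initial gauge distance `B` over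
  all shells, initial near/behind levels, rates at speed `1/τ₁`, and scalar closing conditions (near/behind levels and gauge as in the
  joint loop with `r := 2B̄/ω_K + M`-type core inputs, `B̄ = B·e^{2‖α̃‖₁ M̃ Λ τ₁}`; core: `M̃_W + C_ω·B̄ < M_c`). Outputs on `[0, τ₁]`:
  the gauge deviation bound over all shells (in particular the CORE inputs `r_c` of `…NearBehindStep`), the core clock-weighted sup,
  and the near/behind outputs.

HONEST FRAMING: inequalities about MODEL-lattice certificate flows (graded mirror table on `S♭`, `m = 2`); the template/reference
data and the scalar closing conditions are HYPOTHESES; nothing certified; no item closed; nothing about the Navier–Stokes equations.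
-/

noncomputable section

-- the sub-problem namespace repeats the summit name by design (D-0017)
set_option linter.dupNamespace false

namespace Summit.NavierStokesRegularity.NavierStokesRegularity.Theorems.HopTube.R54

open Set Finset Literature.Analysis.FluidPDE Literature.Analysis.FluidPDE.TaoCascade MirrorPulse RenormFrame QuadPolar
  GappedFrontRobustOn

/-- The renormalised-frame clock `clockW` and the flux clock `clock` are the same function `(1+ε₀)^{5k/2}`.
[cite: Tao2016AveragedNS, §4 (4.1); route TaoLadderRungTwoFlat, bookkeeping] -/
theorem clockW_eq_clock (ε₀ : ℝ) (k : ℤ) : clockW ε₀ k = clock ε₀ k := by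
  unfold clockW clock; rfl

/-- **(4.5) ahead: the clock-weighted amplitude of a certificate flow is eventually below any positive level**, uniformly
on `[0, τ]`: `∃ k₀, ∀ k > k₀, clockW_k·|S_{ik}(s)| ≤ M_c` (`0 < ε₀`, `0 < M_c`).
[cite: Tao2016AveragedNS, §4 Lemma 4.1 (4.5); route TaoLadderRungTwoFlat, in-hop a-priori (finite reduction ahead)] -/
theorem clockW_abs_eventually_le {𝕊 : Finset (ℤ × ℤ × ℤ)} {τ ε₀ : ℝ}
    {α : Fin 2 → Fin 2 → Fin 2 → ℤ × ℤ × ℤ → ℝ} {κ₁ κ₂ : ℝ} {S₀ F₀ B₀ : Fin 2 → ℤ → ℝ}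
    {S F : Fin 2 → ℤ → ℝ → ℝ} (h : PseudoFlowOnShift 𝕊 τ ε₀ α κ₁ κ₂ S₀ F₀ B₀ S F) (hε₀ : 0 < ε₀)
    {Mc : ℝ} (hMc : 0 < Mc) :
    ∃ k₀ : ℤ, 0 ≤ k₀ ∧ ∀ k : ℤ, k₀ < k → ∀ (i : Fin 2), ∀ s ∈ Icc 0 τ, clockW ε₀ k * |S i k s| ≤ Mc := by
  obtain ⟨M, hM⟩ := h.apriori_S
  obtain ⟨N, hN⟩ := exists_nat_gt (M / (Mc * ε₀))
  refine ⟨N, by positivity, fun k hk i s hs => ?_⟩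
  have hq : 0 < 1 + ε₀ := by linarith
  have h1 := hM s hs i k
  have hp : 0 < (1 + ε₀) ^ ((10 : ℝ) * k) := Real.rpow_pos_of_pos hq _
  have hM0 : 0 ≤ M := le_trans (by positivity) h1
  have h2 : (1 + ε₀) ^ ((10 : ℝ) * k) * |S i k s| ≤ M := by
    have : 0 ≤ 1 * |S i k s| := by positivity
    nlinarith
  have hk0 : (0 : ℝ) < k := by exact_mod_cast (lt_of_le_of_lt (by exact_mod_cast (show (0 : ℤ) ≤ N from by positivity)) hk)
  -- clockW_k · |S| = (1+ε₀)^{5k/2 − 10k} · ((1+ε₀)^{10k}|S|) ≤ (1+ε₀)^{−k} · M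
  have h3 : clockW ε₀ k * |S i k s| ≤ (1 + ε₀) ^ (-(k : ℝ)) * M := by
    have e : clockW ε₀ k = (1 + ε₀) ^ ((5 : ℝ) * k / 2 - 10 * k) * (1 + ε₀) ^ ((10 : ℝ) * k) := by
      unfold clockW; rw [← Real.rpow_add hq]; ring_nf
    rw [e, mul_assoc]
    have hexp : (1 + ε₀) ^ ((5 : ℝ) * k / 2 - 10 * k) ≤ (1 + ε₀) ^ (-(k : ℝ)) :=
      Real.rpow_le_rpow_of_exponent_le (by linarith) (by linarith)
    exact mul_le_mul hexp h2 (by positivity) (Real.rpow_nonneg hq.le _)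
  -- (1+ε₀)^{−k} ≤ 1/(1 + kε₀) ≤ Mc/M
  have h4 : (1 + ε₀) ^ (-(k : ℝ)) * M ≤ Mc := by
    have hkN : (N : ℝ) < k := by exact_mod_cast hk
    have hbern : 1 + (k : ℝ) * ε₀ ≤ (1 + ε₀) ^ (k : ℝ) := by
      obtain ⟨kn, hkn⟩ : ∃ kn : ℕ, (kn : ℤ) = k := ⟨k.toNat, Int.toNat_of_nonneg (by exact_mod_cast hk0.le)⟩
      have := one_add_mul_le_pow (by linarith : (-2 : ℝ) ≤ ε₀) kn
      rw [← hkn]; push_cast; rw [Real.rpow_natCast]; linarith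
    have hpos : 0 < 1 + (k : ℝ) * ε₀ := by positivity
    rw [Real.rpow_neg hq.le]
    have h5 : ((1 + ε₀) ^ (k : ℝ))⁻¹ ≤ (1 + (k : ℝ) * ε₀)⁻¹ := inv_anti₀ hpos hbern
    have h6 : (1 + (k : ℝ) * ε₀)⁻¹ * M ≤ Mc := by
      rw [inv_mul_le_iff₀ hpos]
      have h7 : M / (Mc * ε₀) < k := hN.trans hkN
      rw [div_lt_iff₀ (by positivity)] at h7
      nlinarith
    exact (mul_le_mul_of_nonneg_right h5 hM0).trans h6
  exact h3.trans h4

section Loop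

variable {ε ε₀ τ : ℝ} {W₀ S₀ : Fin 2 → ℤ → ℝ} {W FW S FS : Fin 2 → ℤ → ℝ → ℝ}

set_option maxHeartbeats 400000 in
/-- **THE THREE-ZONE IN-HOP A-PRIORI LOOP FOR GRADED FLOWS.** See the module docstring.
[cite: Tao2016AveragedNS, §4 (4.1), (4.3), (4.5), (4.8), §5 (continuity argument), §6.3–6.4 (statement shape); route TaoLadderRungTwoFlat, joint core/near/behind loop (cell LADDER §49.5, §54–§58)] -/
theorem hop_apriori_graded
    (hW : PseudoFlowOnShift shiftSetFlat τ ε₀ (mirrorTable ε ε) 0 0 W₀ (fun i k => (1 / 2) * W₀ i k ^ 2)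
      (fun _ _ => 0) W FW)
    (hS : PseudoFlowOnShift shiftSetFlat τ ε₀ (mirrorTable ε ε) 0 0 S₀ (fun i k => (1 / 2) * S₀ i k ^ 2)
      (fun _ _ => 0) S FS)
    (hε : 0 ≤ ε) (hε₀ : 0 < ε₀) {K D : ℕ} (hDK : K + 1 ≤ D)
    {θV θ' σ τ₁ Aeff A A₀ A₁ M M₁ r μN μB V₀N V₀B VbarN VbarB : ℝ}
    {ω : Fin 2 → ℤ → ℝ} {Λ Cω ωK MtW Mt Mc B Bbar : ℝ}
    (hθV : 0 ≤ θV) (hθ : 0 ≤ θ') (hθ5 : θ' ≤ 5 * Real.log (1 + ε₀)) (hAeff : 0 < Aeff)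
    (hτ₁ : 0 < τ₁) (hτ₁τ : τ₁ ≤ τ) (hστ : σ * τ₁ = 1)
    -- gauge data
    (hωreg : IsWindowRegular (fun i k => ω i k / clockW ε₀ k) Λ) (hCω0 : 0 ≤ Cω)
    (hCω : ∀ (i : Fin 2) (k : ℤ), 1 - (K : ℤ) ≤ k → clockW ε₀ k ≤ Cω * ω i k)
    (hωK : 0 < ωK) (hωKle : ∀ i, ωK ≤ ω i (1 - (K : ℤ)))
    -- reference flow: clock-weighted sup over all shells; template bounds on the near shells
    (hMtW : 0 ≤ MtW) (hWb : ∀ (i : Fin 2) (k : ℤ), ∀ s ∈ Icc 0 τ₁, clockW ε₀ k * |W i k s| ≤ MtW)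
    (hM0 : 0 ≤ M) (hM : ∀ t ∈ Icc 0 τ₁, ∀ i, ∀ m ∈ Finset.Icc (-(D : ℤ)) (1 - (K : ℤ)), |W i m t| ≤ M)
    (hM₁ : ∀ t ∈ Icc 0 τ₁, |W 1 (-(K : ℤ)) t| ≤ M₁)
    -- initial gauge distance over ALL shells
    (hBpos : 0 < B) (hB : ∀ (i : Fin 2) (k : ℤ), ω i k * |S₀ i k - W₀ i k| ≤ B)
    -- the common clock-weighted sup and the far gauge distance
    (hMc : 0 < Mc) (hMtdef : Mt = max (max Mc ((1 + ε₀) ^ ((5 : ℝ) / 2) * Aeff)) MtW)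
    (hBbar : Bbar = B * Real.exp (2 * tableAbsSum shiftSetFlat (renormTable ε₀ (mirrorTable ε ε)) * Mt * Λ * τ₁))
    -- near/behind loop data with the CORE inputs read from the loop levels: `r := 2B̄/ω_K + M`
    (hrdef : r = 2 * Bbar / ωK + M)
    (hAdef : A = Real.sqrt (2 * VbarB) * Real.exp (θ' / 2) * Real.exp (θ' * ((D : ℝ) - K) / 2) + M)
    (hA₀def : A₀ = M + r) (hA₁def : A₁ = M₁ + Real.sqrt (2 * VbarN) * Real.exp (θV / 2))
    (hrA : r ≤ A) (hA₀le : A₀ ≤ Aeff)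
    (hV₀N : coMovingEnergyOn (Finset.Icc (1 - (D : ℤ)) (-(K : ℤ))) θV (-(K : ℝ)) (S - W) 0 ≤ V₀N)
    (hV₀B : ∀ L : ℕ, coMovingEnergyOn (Finset.Icc (1 - (K : ℤ) - L) (-(K : ℤ))) θ' (-(K : ℝ)) S 0 ≤ V₀B)
    (hμN : 0 < μN)
    (hμNle : μN ≤ σ * θV - 2 * (1 + ε) * 1 * (A * Real.sinh (θV / 2) + M * (3 + Real.exp θV)))
    (hμB : 0 < μB) (hμBle : μB ≤ σ * θ' - 2 * (1 + ε) * Aeff * Real.sinh (θ' / 2))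
    (hlevN : V₀N + (Real.exp (θV * ((1 : ℝ) - D + K)) * ((1 + ε) * 1 * A ^ 2 * (A + M))
        + (1 + ε) * 1 * r * (A ^ 2 + M * r)) * τ₁ < VbarN)
    (hlevB : V₀B + A₁ * A₀ * (A₁ + ε * A₀) * τ₁ < VbarB)
    (hclose : Real.sqrt (2 * VbarB) * Real.exp (θ' / 2) ≤ Aeff)
    -- core closing
    (hcloseC : MtW + Cω * Bbar < Mc) :
    (∀ s ∈ Icc 0 τ₁, ∀ (i : Fin 2) (k : ℤ), ω i k * |S i k s - W i k s|
        ≤ B * Real.exp (2 * tableAbsSum shiftSetFlat (renormTable ε₀ (mirrorTable ε ε)) * Mt * Λ * s)) ∧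
      (∀ s ∈ Icc 0 τ₁, ∀ (i : Fin 2) (k : ℤ), 1 - (K : ℤ) ≤ k → clockW ε₀ k * |S i k s| ≤ Mc) ∧
      (∀ s ∈ Icc 0 τ₁, ∀ n : ℤ, n ≤ -(K : ℤ) →
        clock ε₀ n * |S 1 n s| ≤ Aeff ∧ clock ε₀ n * |S 0 (n + 1) s| ≤ Aeff) ∧
      (∀ s ∈ Icc 0 τ₁,
        coMovingEnergyOn (Finset.Icc (1 - (D : ℤ)) (-(K : ℤ))) θV (-(K : ℝ) + σ * s) (S - W) s ≤ VbarN) := by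
  have hε₀' : (-1 : ℝ) < ε₀ := by linarith
  have hσ : 0 < σ := pos_of_mul_pos_left (by rw [hστ]; exact one_pos) hτ₁.le
  have hc : ∀ k, 0 < clockW ε₀ k := clockW_pos hε₀'
  have hωpos : ∀ i k, 0 < ω i k := fun i k => by
    have := hωreg.1 i k
    exact (div_pos_iff_of_pos_right (hc k)).mp this
  have hT0 : 0 ≤ tableAbsSum shiftSetFlat (renormTable ε₀ (mirrorTable ε ε)) := tableAbsSum_nonneg _ _
  have hΛ1 : 1 ≤ Λ := hωreg.2.1
  have hMcMt : Mc ≤ Mt := by rw [hMtdef]; exact (le_max_left _ _).trans (le_max_left _ _)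
  have hAMt : (1 + ε₀) ^ ((5 : ℝ) / 2) * Aeff ≤ Mt := by rw [hMtdef]; exact (le_max_right _ _).trans (le_max_left _ _)
  have hWMt : MtW ≤ Mt := by rw [hMtdef]; exact le_max_right _ _
  have hMt0 : 0 ≤ Mt := hMtW.trans hWMt
  have hrate0 : 0 ≤ 2 * tableAbsSum shiftSetFlat (renormTable ε₀ (mirrorTable ε ε)) * Mt * Λ := by
    have : 0 ≤ Λ := by linarith
    positivity
  have hBbar0 : 0 < Bbar := by rw [hBbar]; exact mul_pos hBpos (Real.exp_pos _)
  have hBBbar : B ≤ Bbar := by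
    rw [hBbar]
    have : 1 ≤ Real.exp (2 * tableAbsSum shiftSetFlat (renormTable ε₀ (mirrorTable ε ε)) * Mt * Λ * τ₁) :=
      Real.one_le_exp (mul_nonneg hrate0 hτ₁.le)
    nlinarith
  have hP52 : (1 : ℝ) ≤ (1 + ε₀) ^ ((5 : ℝ) / 2) := Real.one_le_rpow (by linarith) (by norm_num)
  -- the far-ahead shells: (4.5)
  obtain ⟨k₀', hk₀'0, hk₀'⟩ := clockW_abs_eventually_le hS hε₀ hMc
  set k₀ : ℤ := max k₀' (1 - (K : ℤ)) with hk₀def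
  have htail : ∀ k : ℤ, k₀ < k → ∀ (i : Fin 2), ∀ s ∈ Icc 0 τ₁, clockW ε₀ k * |S i k s| ≤ Mc :=
    fun k hk i s hs => hk₀' k (lt_of_le_of_lt (le_max_left _ _) hk) i s ⟨hs.1, hs.2.trans hτ₁τ⟩
  -- the finite core index set
  set I : Finset (Fin 2 × ℤ) := (Finset.univ : Finset (Fin 2)) ×ˢ Finset.Icc (1 - (K : ℤ)) k₀ with hIdef
  have hI : I.Nonempty := ⟨(0, 1 - (K : ℤ)), by
    rw [hIdef, Finset.mem_product]
    exact ⟨Finset.mem_univ _, Finset.mem_Icc.mpr ⟨le_rfl, le_max_right _ _⟩⟩⟩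
  have hmemI : ∀ (i : Fin 2) (k : ℤ), 1 - (K : ℤ) ≤ k → k ≤ k₀ → (i, k) ∈ I := fun i k h1 h2 => by
    rw [hIdef, Finset.mem_product]; exact ⟨Finset.mem_univ _, Finset.mem_Icc.mpr ⟨h1, h2⟩⟩
  -- the two induction functions
  set f₂ : ℝ → ℝ := fun s => I.sup' hI (fun p => clockW ε₀ p.2 * |S p.1 p.2 s|) with hf₂def
  set f₃ : ℝ → ℝ := fun s => I.sup' hI (fun p => ω p.1 p.2 * |S p.1 p.2 s - W p.1 p.2 s|) with hf₃def
  have hf₂le : ∀ s a, f₂ s ≤ a ↔ ∀ p ∈ I, clockW ε₀ p.2 * |S p.1 p.2 s| ≤ a := fun s a => by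
    rw [hf₂def]; exact Finset.sup'_le_iff hI _
  have hf₃le : ∀ s a, f₃ s ≤ a ↔ ∀ p ∈ I, ω p.1 p.2 * |S p.1 p.2 s - W p.1 p.2 s| ≤ a := fun s a => by
    rw [hf₃def]; exact Finset.sup'_le_iff hI _
  have hScont : ∀ i k, ContinuousOn (S i k) (Icc 0 τ₁) := fun i k =>
    (QuadPolar.continuousOn_of_pseudoFlowOnShift hS i k).mono (Icc_subset_Icc le_rfl hτ₁τ)
  have hWcont : ∀ i k, ContinuousOn (W i k) (Icc 0 τ₁) := fun i k =>
    (QuadPolar.continuousOn_of_pseudoFlowOnShift hW i k).mono (Icc_subset_Icc le_rfl hτ₁τ)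
  have hf₂cont : ContinuousOn f₂ (Icc 0 τ₁) := by
    rw [hf₂def]
    exact ContinuousOn.finset_sup'_apply hI fun p _ => continuousOn_const.mul (hScont p.1 p.2).abs
  have hf₃cont : ContinuousOn f₃ (Icc 0 τ₁) := by
    rw [hf₃def]
    exact ContinuousOn.finset_sup'_apply hI fun p _ => continuousOn_const.mul ((hScont p.1 p.2).sub (hWcont p.1 p.2)).abs
  -- levels
  have hab₂ : MtW + Cω * Bbar < Mc := hcloseC
  have hab₃ : Bbar < 2 * Bbar := by linarith
  -- initial values
  have hf₂0 : f₂ 0 ≤ MtW + Cω * Bbar := by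
    rw [hf₂le]
    rintro ⟨i, k⟩ hp
    have hk : 1 - (K : ℤ) ≤ k := by
      rw [hIdef, Finset.mem_product, Finset.mem_Icc] at hp; exact hp.2.1
    have h1 : clockW ε₀ k * |S i k 0| ≤ clockW ε₀ k * |W i k 0| + clockW ε₀ k * |S i k 0 - W i k 0| := by
      rw [← mul_add]
      refine mul_le_mul_of_nonneg_left ?_ (hc k).le
      have := abs_sub_abs_le_abs_sub (S i k 0) (W i k 0); linarith
    have h2 := hWb i k 0 ⟨le_rfl, hτ₁.le⟩
    have h3 : clockW ε₀ k * |S i k 0 - W i k 0| ≤ Cω * Bbar := by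
      have hd : ω i k * |S i k 0 - W i k 0| ≤ Bbar := by
        rw [hS.init_S, hW.init_S]; exact (hB i k).trans hBBbar
      calc clockW ε₀ k * |S i k 0 - W i k 0| ≤ Cω * ω i k * |S i k 0 - W i k 0| :=
            mul_le_mul_of_nonneg_right (hCω i k hk) (abs_nonneg _)
        _ = Cω * (ω i k * |S i k 0 - W i k 0|) := by ring
        _ ≤ Cω * Bbar := mul_le_mul_of_nonneg_left hd hCω0
    linarith
  have hf₃0 : f₃ 0 ≤ Bbar := by
    rw [hf₃le]
    rintro ⟨i, k⟩ -
    rw [hS.init_S, hW.init_S]; exact (hB i k).trans hBBbar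
  -- THE STEP
  have key := Bootstrap.Icc_induction₂ (T := τ₁) (a₁ := Mc) (b₁ := MtW + Cω * Bbar) (a₂ := 2 * Bbar) (b₂ := Bbar)
    hτ₁.le hf₂cont hf₃cont hab₂ hab₃ hf₂0 hf₃0 ?_
  · -- CONCLUSIONS from `key`
    have hcore : ∀ s ∈ Icc 0 τ₁, ∀ (i : Fin 2) (k : ℤ), 1 - (K : ℤ) ≤ k → clockW ε₀ k * |S i k s| ≤ Mc := by
      intro s hs i k hk
      by_cases hkk : k ≤ k₀
      · exact (((hf₂le s _).mp (key s hs).1) (i, k) (hmemI i k hk hkk)).trans hab₂.le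
      · exact htail k (not_le.mp hkk) i s hs
    have hdev1K : ∀ s ∈ Icc 0 τ₁, ∀ i, |(S - W) i (1 - (K : ℤ)) s| ≤ r := by
      intro s hs i
      have h1 := ((hf₃le s _).mp (key s hs).2) (i, 1 - (K : ℤ)) (hmemI i _ le_rfl (le_max_right _ _))
      simp only at h1
      have h2 : |S i (1 - (K : ℤ)) s - W i (1 - (K : ℤ)) s| ≤ Bbar / ωK := by
        rw [le_div_iff₀ hωK]
        calc |S i (1 - (K : ℤ)) s - W i (1 - (K : ℤ)) s| * ωK
            ≤ |S i (1 - (K : ℤ)) s - W i (1 - (K : ℤ)) s| * ω i (1 - (K : ℤ)) :=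
              mul_le_mul_of_nonneg_left (hωKle i) (abs_nonneg _)
          _ ≤ Bbar := by rw [mul_comm]; exact h1
      have h3 : Bbar / ωK ≤ r := by
        rw [hrdef]
        have : 0 ≤ Bbar / ωK := div_nonneg hBbar0.le hωK.le
        have : Bbar / ωK ≤ 2 * Bbar / ωK := by rw [mul_div_assoc]; linarith
        linarith
      simpa only [Pi.sub_apply] using h2.trans h3
    have hr0 : 0 ≤ r := by rw [hrdef]; positivity
    obtain ⟨hbd, -, hnear, -⟩ := near_behind_apriori_of_pseudoFlows_sharp hW hS hε hε₀ hDK hθV hθ hθ5 hAeff hτ₁ hτ₁τ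
      hστ hM0 hM hM₁ hdev1K hr0 hAdef hA₀def hA₁def hrA hA₀le hV₀N hV₀B hμN hμNle hμB hμBle hlevN hlevB hclose
    -- the gauge deviation over ALL shells on `[0, τ₁]` (Grönwall with the established sups)
    have hSb : ∀ (i : Fin 2) (k : ℤ), ∀ s ∈ Icc 0 τ₁, clockW ε₀ k * |S i k s| ≤ Mt := by
      intro i k s hs
      by_cases hk : 1 - (K : ℤ) ≤ k
      · exact (hcore s hs i k hk).trans hMcMt
      · rw [not_le] at hk
        fin_cases i
        · -- species 0 at shell `k ≤ −K`: bond `k − 1`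
          have h := (hbd s hs (k - 1) (by omega)).2
          rw [sub_add_cancel, ← clockW_eq_clock] at h
          have h2 : clockW ε₀ k ≤ (1 + ε₀) ^ ((5 : ℝ) / 2) * clockW ε₀ (k - 1) :=
            clockW_le_of_le_succ hε₀.le (by omega)
          calc clockW ε₀ k * |S 0 k s| ≤ (1 + ε₀) ^ ((5 : ℝ) / 2) * clockW ε₀ (k - 1) * |S 0 k s| :=
                mul_le_mul_of_nonneg_right h2 (abs_nonneg _)
            _ = (1 + ε₀) ^ ((5 : ℝ) / 2) * (clockW ε₀ (k - 1) * |S 0 k s|) := by ring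
            _ ≤ (1 + ε₀) ^ ((5 : ℝ) / 2) * Aeff := mul_le_mul_of_nonneg_left h (by positivity)
            _ ≤ Mt := hAMt
        · have h := (hbd s hs k (by omega)).1
          rw [← clockW_eq_clock] at h
          calc clockW ε₀ k * |S 1 k s| ≤ Aeff := h
            _ ≤ (1 + ε₀) ^ ((5 : ℝ) / 2) * Aeff := le_mul_of_one_le_left hAeff.le hP52
            _ ≤ Mt := hAMt
    have hWb' : ∀ (i : Fin 2) (k : ℤ), ∀ s ∈ Icc 0 τ₁, clockW ε₀ k * |W i k s| ≤ Mt :=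
      fun i k s hs => (hWb i k s hs).trans hWMt
    have hS' := pseudoFlowOnShift_mono hS hτ₁ hτ₁τ
    have hW' := pseudoFlowOnShift_mono hW hτ₁ hτ₁τ
    refine ⟨fun s hs i k => ?_, hcore, hbd, hnear⟩
    exact gauge_deviation_of_gradedFlows hW' hS' hε₀.le hωreg hSb hWb' hB i k hs
  · -- THE STEP: sups on `[0, t]` ⇒ the loop and Grönwall on `[0, t]` ⇒ strict improvement at `t`
    intro t ht hpast
    rcases eq_or_lt_of_le ht.1 with h0t | htpos
    · rw [← h0t]; exact ⟨hf₂0, hf₃0⟩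
    have htτ : t ≤ τ := ht.2.trans hτ₁τ
    -- core data on `[0, t]` from the past
    have hcore_t : ∀ s ∈ Icc 0 t, ∀ (i : Fin 2) (k : ℤ), 1 - (K : ℤ) ≤ k → clockW ε₀ k * |S i k s| ≤ Mc := by
      intro s hs i k hk
      by_cases hkk : k ≤ k₀
      · exact ((hf₂le s _).mp (hpast s hs).1) (i, k) (hmemI i k hk hkk)
      · exact htail k (not_le.mp hkk) i s ⟨hs.1, hs.2.trans ht.2⟩
    have hdev1K : ∀ s ∈ Icc 0 t, ∀ i, |(S - W) i (1 - (K : ℤ)) s| ≤ r := by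
      intro s hs i
      have h1 := ((hf₃le s _).mp (hpast s hs).2) (i, 1 - (K : ℤ)) (hmemI i _ le_rfl (le_max_right _ _))
      simp only at h1
      have h2 : |S i (1 - (K : ℤ)) s - W i (1 - (K : ℤ)) s| ≤ 2 * Bbar / ωK := by
        rw [le_div_iff₀ hωK]
        calc |S i (1 - (K : ℤ)) s - W i (1 - (K : ℤ)) s| * ωK
            ≤ |S i (1 - (K : ℤ)) s - W i (1 - (K : ℤ)) s| * ω i (1 - (K : ℤ)) :=
              mul_le_mul_of_nonneg_left (hωKle i) (abs_nonneg _)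
          _ ≤ 2 * Bbar := by rw [mul_comm]; exact h1
      have h3 : 2 * Bbar / ωK ≤ r := by rw [hrdef]; linarith
      simpa only [Pi.sub_apply] using h2.trans h3
    have hr0 : 0 ≤ r := by rw [hrdef]; positivity
    -- the near/behind loop on `[0, t]` (speed `1/t`)
    have hσ't : (1 / t) * t = 1 := by rw [one_div, inv_mul_cancel₀ (ne_of_gt htpos)]
    have h1t : σ ≤ 1 / t := by
      rw [le_div_iff₀ htpos]
      calc σ * t ≤ σ * τ₁ := mul_le_mul_of_nonneg_left ht.2 hσ.le
        _ = 1 := hστ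
    have hμNle' : μN ≤ (1 / t) * θV - 2 * (1 + ε) * 1 * (A * Real.sinh (θV / 2) + M * (3 + Real.exp θV)) := by
      have h2 := mul_le_mul_of_nonneg_right h1t hθV
      linarith only [h2, hμNle]
    have hμBle' : μB ≤ (1 / t) * θ' - 2 * (1 + ε) * Aeff * Real.sinh (θ' / 2) := by
      have h2 := mul_le_mul_of_nonneg_right h1t hθ
      linarith only [h2, hμBle]
    have hEN0 : 0 ≤ Real.exp (θV * ((1 : ℝ) - D + K)) * ((1 + ε) * 1 * A ^ 2 * (A + M))
        + (1 + ε) * 1 * r * (A ^ 2 + M * r) := by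
      have hA0 : 0 ≤ A := hr0.trans hrA
      positivity
    have hlevN' : V₀N + (Real.exp (θV * ((1 : ℝ) - D + K)) * ((1 + ε) * 1 * A ^ 2 * (A + M))
        + (1 + ε) * 1 * r * (A ^ 2 + M * r)) * t < VbarN := by
      have h2 := mul_le_mul_of_nonneg_left ht.2 hEN0
      linarith only [h2, hlevN]
    have hA₁0 : 0 ≤ A₁ := by
      rw [hA₁def]
      have hM₁0 : 0 ≤ M₁ := (abs_nonneg _).trans (hM₁ 0 ⟨le_rfl, hτ₁.le⟩)
      exact add_nonneg hM₁0 (mul_nonneg (Real.sqrt_nonneg _) (Real.exp_pos _).le)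
    have hA₀0 : 0 ≤ A₀ := by rw [hA₀def]; exact add_nonneg hM0 hr0
    have hEtop0 : 0 ≤ A₁ * A₀ * (A₁ + ε * A₀) :=
      mul_nonneg (mul_nonneg hA₁0 hA₀0) (add_nonneg hA₁0 (mul_nonneg hε hA₀0))
    have hlevB' : V₀B + A₁ * A₀ * (A₁ + ε * A₀) * t < VbarB := by
      have h2 := mul_le_mul_of_nonneg_left ht.2 hEtop0
      linarith only [h2, hlevB]
    obtain ⟨hbd, -, -, -⟩ := near_behind_apriori_of_pseudoFlows_sharp (σ := 1 / t) (τ₁ := t) hW hS hε hε₀ hDK hθV hθ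
      hθ5 hAeff htpos htτ hσ't hM0 (fun s hs => hM s ⟨hs.1, hs.2.trans ht.2⟩)
      (fun s hs => hM₁ s ⟨hs.1, hs.2.trans ht.2⟩) hdev1K hr0 hAdef hA₀def hA₁def hrA hA₀le hV₀N hV₀B hμN hμNle'
      hμB hμBle' hlevN' hlevB' hclose
    -- the clock-weighted sups of both flows on `[0, t]`, over ALL shells
    have hSb : ∀ (i : Fin 2) (k : ℤ), ∀ s ∈ Icc 0 t, clockW ε₀ k * |S i k s| ≤ Mt := by
      intro i k s hs
      by_cases hk : 1 - (K : ℤ) ≤ k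
      · exact (hcore_t s hs i k hk).trans hMcMt
      · rw [not_le] at hk
        fin_cases i
        · have h := (hbd s hs (k - 1) (by omega)).2
          rw [sub_add_cancel, ← clockW_eq_clock] at h
          have h2 : clockW ε₀ k ≤ (1 + ε₀) ^ ((5 : ℝ) / 2) * clockW ε₀ (k - 1) :=
            clockW_le_of_le_succ hε₀.le (by omega)
          calc clockW ε₀ k * |S 0 k s| ≤ (1 + ε₀) ^ ((5 : ℝ) / 2) * clockW ε₀ (k - 1) * |S 0 k s| :=
                mul_le_mul_of_nonneg_right h2 (abs_nonneg _)
            _ = (1 + ε₀) ^ ((5 : ℝ) / 2) * (clockW ε₀ (k - 1) * |S 0 k s|) := by ring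
            _ ≤ (1 + ε₀) ^ ((5 : ℝ) / 2) * Aeff := mul_le_mul_of_nonneg_left h (by positivity)
            _ ≤ Mt := hAMt
        · have h := (hbd s hs k (by omega)).1
          rw [← clockW_eq_clock] at h
          calc clockW ε₀ k * |S 1 k s| ≤ Aeff := h
            _ ≤ (1 + ε₀) ^ ((5 : ℝ) / 2) * Aeff := le_mul_of_one_le_left hAeff.le hP52
            _ ≤ Mt := hAMt
    have hWb' : ∀ (i : Fin 2) (k : ℤ), ∀ s ∈ Icc 0 t, clockW ε₀ k * |W i k s| ≤ Mt :=
      fun i k s hs => (hWb i k s ⟨hs.1, hs.2.trans ht.2⟩).trans hWMt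
    -- Grönwall on `[0, t]`
    have hS' := pseudoFlowOnShift_mono hS htpos htτ
    have hW' := pseudoFlowOnShift_mono hW htpos htτ
    have hdev : ∀ (i : Fin 2) (k : ℤ), ω i k * |S i k t - W i k t| ≤ Bbar := by
      intro i k
      have h := gauge_deviation_of_gradedFlows hW' hS' hε₀.le hωreg hSb hWb' hB i k ⟨ht.1, le_rfl⟩
      refine h.trans ?_
      rw [hBbar]
      exact mul_le_mul_of_nonneg_left (Real.exp_le_exp.mpr (mul_le_mul_of_nonneg_left ht.2 hrate0)) hBpos.le
    refine ⟨(hf₂le t _).mpr ?_, (hf₃le t _).mpr fun p _ => hdev p.1 p.2⟩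
    rintro ⟨i, k⟩ hp
    have hk : 1 - (K : ℤ) ≤ k := by
      rw [hIdef, Finset.mem_product, Finset.mem_Icc] at hp; exact hp.2.1
    have h1 : clockW ε₀ k * |S i k t| ≤ clockW ε₀ k * |W i k t| + clockW ε₀ k * |S i k t - W i k t| := by
      rw [← mul_add]
      refine mul_le_mul_of_nonneg_left ?_ (hc k).le
      have := abs_sub_abs_le_abs_sub (S i k t) (W i k t); linarith
    have h2 := hWb i k t ht
    have h3 : clockW ε₀ k * |S i k t - W i k t| ≤ Cω * Bbar := by
      calc clockW ε₀ k * |S i k t - W i k t| ≤ Cω * ω i k * |S i k t - W i k t| :=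
            mul_le_mul_of_nonneg_right (hCω i k hk) (abs_nonneg _)
        _ = Cω * (ω i k * |S i k t - W i k t|) := by ring
        _ ≤ Cω * Bbar := mul_le_mul_of_nonneg_left (hdev i k) hCω0
    simp only
    linarith

end Loop

end Summit.NavierStokesRegularity.NavierStokesRegularity.Theorems.HopTube.R54

end
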